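import Literature.IUT.HodgeTheaters.StableCurveTemperedDataOfSpecialFibre
import Literature.IUT.HodgeTheaters.TemperedCoveringsCor23Assembly
import Literature.IUT.HodgeTheaters.TemperedCoveringsCor23iiiMLF
import Literature.FieldTheory.Galois.FixingSubgroupAbsoluteGalois
import Literature.AnabelianGeometry.AbsoluteAnabelian.SlimTransport
import HarnessLib

/-!
# [IUTchI] Corollary 2.3 (i)–(iv) at the GENUINE 𝔛-datum `StableCurveTemperedData.ofSpecialFibre`:
# the topological side conditions and "`Z(G_k) = 1`" DISCHARGED, the slimness input in its `ℍ`-free form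

Mochizuki, *Inter-universal Teichmüller theory I: construction of Hodge theaters*, kurims manuscript
(May 2020), §2, Corollary 2.3 (i)–(iv) pp. 47–49 [cite: Mochizuki2012, Cor 2.3 pp.47-49] (D-0012 claim
key; series status DISPUTED; nothing of the series is asserted here).  Node `IUTchI:Cor2.3(iii)` (board
holder abc-iut-w4-d058) at the L3↔L5 MERGE (plan/GAP-LEDGER.md G-w4d058-1, disposition "prove in-cone
at the L3↔L5 merge"), over abc-iut-L5-t11's BRIDGE `StableCurveTemperedData.ofSpecialFibre`
(`StableCurveTemperedDataOfSpecialFibre.lean`): the [IUTchI] §2 𝔛-datum of a tempered curve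
`X : TemperedCurve p` ([SemiAnbd] §6 interface) with group-level data `d` and special-fibre data `S`
([SemiAnbd] Ex. 3.10), whose `Π̂_X := Π_{X_K}`, `G_k := G_K = Gal(K̄/K) ≤ G_{ℚ_p}`, `Δ̂_X ↠ Π̂_𝔾`
CONSTRUCTED.

PROOF-ONLY (no definition, no new named fact).  At this datum the hypotheses of the landed Cor. 2.3
kernels that the abstract interface `StableCurveTemperedData` could not supply become THEOREMS:

* `TemperedCurve.isSlimGroup_GK`, `TemperedCurve.center_GK_eq_bot` — **"[AbsAnab], Theorem 1.1.1,
  (ii)" for `G_K`** (p. 47): the closed subgroup `G_K = Gal(K̄/K) ≤ G_{ℚ_p}` of a `TemperedCurve p` is slim,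
  hence centre-free, from the tree's PROVED `galoisMLF_slim_holds` (abc-iut-L4-d2) transported along
  `Literature.FieldTheory.Galois.fixingSubgroupEquivAbsoluteGaloisGroup` (`G_K ≃ₜ* Gal(K̄/K)`,
  abc-iut-L3-t12) by `AbsoluteAnabelian.isSlimGroup_of_continuousMulEquiv` (the [EtTh]-side twin for
  `ThetaSetting.GK` is abc-iut-L2-t8's `GKCenterFreeHolds`); hence `ofSpecialFibre_center_Gk_eq_bot`;
* `ofSpecialFibre_t2Space_piHat`, `ofSpecialFibre_totallyDisconnectedSpace_piHat`,
  `ofSpecialFibre_t2Space_graphHat` — `Π̂_X`, `Π̂_𝔾` are profinite completions (`IsProfiniteCompletion`);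
* `ofSpecialFibre_isClosed_deltaHat` — `Δ̂_X = Ker(Π̂_X → G_K)` is closed (it is the closure of
  `Δ^temp_X`, abc-iut-w5-d139's `ker_augHat_eq_deltaHat`);
* `ofSpecialFibre_continuous_ρHat` — the constructed `Δ̂_X ↠ Π̂_𝔾` is continuous.

Consequently (`cor23_i_to_iv_ofSpecialFibre`, and the by-name-slimness forms
`cor23iii_ofSpecialFibre_of_slim` / `cor23iv_ofSpecialFibre_of_slim`)
Cor. 2.3 (i)–(iv) AS TYPED hold at the genuine datum from EXACTLY: Prop. 2.2 for the special-fibre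
𝔾-data (`h22`, abc-iut-L5-t11's `cor23i_of_prop22`); the two density facts of (ii) (`hH`, `hker`,
abc-iut-L5-d4's `cor23ii_of_density`); the `ℍ`-FREE level conclusions (KER-LEVEL) of the printed proof
of the first sentence of (iii) over a cofinal tower of normal open `J ⊆ Δ̂_X` (`hA` under (a) / `hB`
under (b), abc-iut-w4-d058's `TemperedCoveringsSlimnessKerForm`, themselves reducible per level to the
printed inputs by `mem_level_of_comm_ker_of_inputs`); and the outer-descent atoms of the (i) "in
particular" (`hOutTp`, `hOutHat`; 𝔾-level `G_k`-stability of `ℍ`, `outerTp_of_graphStable`).  The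
HELD status of the node is unchanged (these are the merge obligations of G-w4d058-1 and of the (i)/(ii)
sub-DAG rows); what this file removes from the ledger of hypotheses are the topological side conditions
and the `G_k` input.  Model-RELATIVE (∀ `X`, `d`, `S`), as the bridge itself; nothing here bears on
[IUTchIII] Cor. 3.12; typed ≠ discharged.
-/

noncomputable section

namespace Literature.AnabelianGeometry.SemiGraphs.TemperedCurve

open Literature.AlgebraicGeometry.Frobenioids (IsSlimGroup)
open Literature.AnabelianGeometry.AbsoluteAnabelian (galoisMLF_slim_holds)

variable {p : ℕ} [Fact p.Prime]

/-- **`G_K` is slim** for the base field of a `TemperedCurve p`: `G_K = K.fixingSubgroup ≤ G_{ℚ_p}` is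
topologically isomorphic to `Gal(K̄/K)` (`fixingSubgroupEquivAbsoluteGaloisGroup`), which is slim by the
tree's PROVED [AbsAnab] Thm. 1.1.1 (ii), local half (`galoisMLF_slim_holds`).
[cite: MochizukiAbsAnab2004, Thm 1.1.1 (ii) p.6] -/
theorem isSlimGroup_GK (X : TemperedCurve p) : IsSlimGroup X.GK := by
  haveI := X.finiteDimensional_K
  change IsSlimGroup X.K.fixingSubgroup
  exact Literature.AnabelianGeometry.AbsoluteAnabelian.isSlimGroup_of_continuousMulEquiv
    (Literature.FieldTheory.Galois.fixingSubgroupEquivAbsoluteGaloisGroup X.K).symm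
    (galoisMLF_slim_holds p X.K)

/-- **"[AbsAnab], Theorem 1.1.1, (ii)" for `G_K`, as Cor. 2.3 (iii) uses it** ([IUTchI] p. 47):
`Z(G_K) = 1`. [cite: Mochizuki2012, Cor 2.3(iii) p.47] -/
theorem center_GK_eq_bot (X : TemperedCurve p) : Subgroup.center X.GK = ⊥ :=
  Literature.IUT.HodgeTheaters.center_eq_bot_of_isSlimGroup (isSlimGroup_GK X)

end Literature.AnabelianGeometry.SemiGraphs.TemperedCurve

namespace Literature.IUT.HodgeTheaters

open Pointwise Topology
open Literature.AlgebraicGeometry.Frobenioids (IsSlimGroup)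
open Literature.AnabelianGeometry.SemiGraphs

namespace StableCurveTemperedData

section

variable {p : ℕ} [Fact p.Prime] (X : TemperedCurve p) (d : X.GroupLevelData)
  (S : SpecialFibreData (X.toTemperedArithmeticGroup d)) (h36 : S.Gc.Prop36Hypotheses)
  (Sigma SigmaHat : Set ℕ) (hsub : Sigma ⊆ SigmaHat) (hne : Sigma.Nonempty)
  (hprime : ∀ q ∈ SigmaHat, q.Prime) (hp : p ∉ Sigma)
  (TpH : Subgroup S.chart.G)
  (HatH : Subgroup (TemperedGraphGroupData.exists_completion_of_prop36 S.Gc h36 S.chart).choose)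
  (hle : TpH.map (TemperedGraphGroupData.exists_completion_of_prop36 S.Gc h36
    S.chart).choose_spec.choose.toMonoidHom ≤ HatH)
  (cuspMeetsH : {x : X.Pt // X.IsCusp x} → Prop)

/-! ### The side conditions and the `G_k` input, DISCHARGED at the genuine datum -/

/-- `Π̂_X = Π_{X_K}` of the datum is Hausdorff (a profinite completion). ([IUTchI] §2 p.46) [claim: Mochizuki2012, status: disputed] -/
theorem ofSpecialFibre_t2Space_piHat :
    T2Space (ofSpecialFibre X d S h36 Sigma SigmaHat hsub hne hprime hp TpH HatH hle cuspMeetsH).PiHat :=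
  X.isProfiniteCompletion_toHat.t2Space

/-- `Π̂_X = Π_{X_K}` of the datum is totally disconnected. ([IUTchI] §2 p.46) [claim: Mochizuki2012, status: disputed] -/
theorem ofSpecialFibre_totallyDisconnectedSpace_piHat :
    TotallyDisconnectedSpace
      (ofSpecialFibre X d S h36 Sigma SigmaHat hsub hne hprime hp TpH HatH hle cuspMeetsH).PiHat :=
  X.isProfiniteCompletion_toHat.totallyDisconnectedSpace

/-- `Π̂_𝔾` of the datum (the chosen profinite completion of `π₁^temp(G^c)`) is Hausdorff.
([IUTchI] §2 p.47) [claim: Mochizuki2012, status: disputed] -/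
theorem ofSpecialFibre_t2Space_graphHat :
    T2Space (ofSpecialFibre X d S h36 Sigma SigmaHat hsub hne hprime hp TpH HatH hle cuspMeetsH).graph.Hat :=
  (OfSpecialFibre.iotaG_isProfiniteCompletion X d S h36).t2Space

/-- `Δ̂_X = Ker(Π_{X_K} → G_K)` of the datum is CLOSED in `Π̂_X` (it is the closure of `Δ^temp_X`,
`ker_augHatGK_eq_deltaHat`). ([IUTchI] §2 p.47) [claim: Mochizuki2012, status: disputed] -/
theorem ofSpecialFibre_isClosed_deltaHat :
    IsClosed ((ofSpecialFibre X d S h36 Sigma SigmaHat hsub hne hprime hp TpH HatH hle cuspMeetsH).DeltaHat :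
      Set (ofSpecialFibre X d S h36 Sigma SigmaHat hsub hne hprime hp TpH HatH hle cuspMeetsH).PiHat) := by
  change IsClosed ((OfSpecialFibre.augHatGK X).ker : Set X.PiHat)
  rw [OfSpecialFibre.ker_augHatGK_eq_deltaHat X d]
  exact Subgroup.isClosed_topologicalClosure _

/-- The constructed `Δ̂_X ↠ Π̂_𝔾` of the datum is CONTINUOUS (it is the continuous extension `rhoHatExt`
read on `Ker(Π̂_X → G_K) = Δ_X`). ([IUTchI] §2 p.47) [claim: Mochizuki2012, status: disputed] -/
theorem ofSpecialFibre_continuous_ρHat :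
    Continuous (ofSpecialFibre X d S h36 Sigma SigmaHat hsub hne hprime hp TpH HatH hle cuspMeetsH).ρHat := by
  change Continuous (OfSpecialFibre.rhoHat X d S h36)
  refine (OfSpecialFibre.rhoHatExt X d S h36).continuous.comp ?_
  refine continuous_induced_rng.2 ?_
  exact continuous_subtype_val

/-- **"[AbsAnab], Theorem 1.1.1, (ii)" DISCHARGED at the datum**: `Z(G_k) = 1` for `G_k := G_K`.
([IUTchI] Cor 2.3(iii) p.47) [claim: Mochizuki2012, status: disputed] -/
theorem ofSpecialFibre_center_Gk_eq_bot :
    Subgroup.center (ofSpecialFibre X d S h36 Sigma SigmaHat hsub hne hprime hp TpH HatH hle cuspMeetsH).Gk = ⊥ :=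
  X.center_GK_eq_bot

/-! ### Cor. 2.3 (i)–(iv) AS TYPED at the genuine datum -/

/-- **[IUTchI] Cor. 2.3 (i)–(iv) AS TYPED at the genuine 𝔛-datum `ofSpecialFibre X d S …`**, from
EXACTLY: Prop. 2.2 for the special-fibre 𝔾-data (`h22`); the density facts of (ii) (`hH`:
`Π̂_ℍ = cl Π^tp_ℍ`; `hker`: `Ker ρ̂ = cl(Ker ρ̂ ∩ Δ^tp_X)`); the `ℍ`-free level conclusions of the
printed proof of (iii)'s first sentence over a cofinal family `J` of normal open subgroups of `Δ̂_X`
(`hcof`; `hA` under (a), `hB` under (b) — each level reducible to the printed inputs by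
`mem_level_of_comm_ker_of_inputs`); the outer-descent atoms (`hOutTp`, `hOutHat`).  DISCHARGED here
(no longer hypotheses): `Π̂_X` Hausdorff and totally disconnected, `Π̂_𝔾` Hausdorff, `Δ̂_X` closed,
`Δ̂_X ↠ Π̂_𝔾` continuous, `Z(G_k) = 1`. [cite: Mochizuki2012, Cor 2.3 pp.47-49] -/
theorem cor23_i_to_iv_ofSpecialFibre
    (h22 : (ofSpecialFibre X d S h36 Sigma SigmaHat hsub hne hprime hp TpH HatH hle
      cuspMeetsH).graph.CommensuratorsOfDecompositionSubgroups)
    (hH : ((ofSpecialFibre X d S h36 Sigma SigmaHat hsub hne hprime hp TpH HatH hle cuspMeetsH).graph.HatH :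
        Set (ofSpecialFibre X d S h36 Sigma SigmaHat hsub hne hprime hp TpH HatH hle cuspMeetsH).graph.Hat) =
      closure ((ofSpecialFibre X d S h36 Sigma SigmaHat hsub hne hprime hp TpH HatH hle cuspMeetsH).graph.ι ''
        (ofSpecialFibre X d S h36 Sigma SigmaHat hsub hne hprime hp TpH HatH hle cuspMeetsH).graph.TpH))
    (hker : ((ofSpecialFibre X d S h36 Sigma SigmaHat hsub hne hprime hp TpH HatH hle cuspMeetsH).ρHat.ker :
        Set (ofSpecialFibre X d S h36 Sigma SigmaHat hsub hne hprime hp TpH HatH hle cuspMeetsH).DeltaHat) ⊆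
      closure (((ofSpecialFibre X d S h36 Sigma SigmaHat hsub hne hprime hp TpH HatH hle cuspMeetsH).ιΔ.range :
          Set (ofSpecialFibre X d S h36 Sigma SigmaHat hsub hne hprime hp TpH HatH hle cuspMeetsH).DeltaHat) ∩
        ((ofSpecialFibre X d S h36 Sigma SigmaHat hsub hne hprime hp TpH HatH hle cuspMeetsH).ρHat.ker :
          Set (ofSpecialFibre X d S h36 Sigma SigmaHat hsub hne hprime hp TpH HatH hle cuspMeetsH).DeltaHat)))
    (hOutTp : ∀ g : (ofSpecialFibre X d S h36 Sigma SigmaHat hsub hne hprime hp TpH HatH hle cuspMeetsH).PiTp,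
      ∃ δ : (ofSpecialFibre X d S h36 Sigma SigmaHat hsub hne hprime hp TpH HatH hle cuspMeetsH).DeltaTp,
        MulAut.conj g • ((ofSpecialFibre X d S h36 Sigma SigmaHat hsub hne hprime hp TpH HatH hle
            cuspMeetsH).deltaTpH.map
          (ofSpecialFibre X d S h36 Sigma SigmaHat hsub hne hprime hp TpH HatH hle cuspMeetsH).DeltaTp.subtype) =
        MulAut.conj (δ : (ofSpecialFibre X d S h36 Sigma SigmaHat hsub hne hprime hp TpH HatH hle
            cuspMeetsH).PiTp) •
          ((ofSpecialFibre X d S h36 Sigma SigmaHat hsub hne hprime hp TpH HatH hle cuspMeetsH).deltaTpH.map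
            (ofSpecialFibre X d S h36 Sigma SigmaHat hsub hne hprime hp TpH HatH hle cuspMeetsH).DeltaTp.subtype))
    (hOutHat : ∀ γ : (ofSpecialFibre X d S h36 Sigma SigmaHat hsub hne hprime hp TpH HatH hle cuspMeetsH).PiHat,
      ∃ δ : (ofSpecialFibre X d S h36 Sigma SigmaHat hsub hne hprime hp TpH HatH hle cuspMeetsH).DeltaHat,
        MulAut.conj γ • ((ofSpecialFibre X d S h36 Sigma SigmaHat hsub hne hprime hp TpH HatH hle
            cuspMeetsH).deltaHatH.map
          (ofSpecialFibre X d S h36 Sigma SigmaHat hsub hne hprime hp TpH HatH hle cuspMeetsH).DeltaHat.subtype) =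
        MulAut.conj (δ : (ofSpecialFibre X d S h36 Sigma SigmaHat hsub hne hprime hp TpH HatH hle
            cuspMeetsH).PiHat) •
          ((ofSpecialFibre X d S h36 Sigma SigmaHat hsub hne hprime hp TpH HatH hle cuspMeetsH).deltaHatH.map
            (ofSpecialFibre X d S h36 Sigma SigmaHat hsub hne hprime hp TpH HatH hle cuspMeetsH).DeltaHat.subtype))
    {I : Type*}
    (J : I → Subgroup (ofSpecialFibre X d S h36 Sigma SigmaHat hsub hne hprime hp TpH HatH hle cuspMeetsH).DeltaHat)
    (hcof : ∀ W : Subgroup (ofSpecialFibre X d S h36 Sigma SigmaHat hsub hne hprime hp TpH HatH hle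
        cuspMeetsH).DeltaHat,
      W.Normal → IsOpen (W : Set (ofSpecialFibre X d S h36 Sigma SigmaHat hsub hne hprime hp TpH HatH hle
        cuspMeetsH).DeltaHat) → ∃ i, J i ≤ W)
    (hA : (∃ l ∈ SigmaHat, l ∉ Sigma ∧ l ≠ p) →
      ∀ i (a : (ofSpecialFibre X d S h36 Sigma SigmaHat hsub hne hprime hp TpH HatH hle cuspMeetsH).DeltaHat),
        (∀ x ∈ J i, x ∈ (ofSpecialFibre X d S h36 Sigma SigmaHat hsub hne hprime hp TpH HatH hle
          cuspMeetsH).ρHat.ker → a * x = x * a) → a ∈ J i)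
    (hB : SigmaHat = {q | q.Prime} →
      ∀ i (a : (ofSpecialFibre X d S h36 Sigma SigmaHat hsub hne hprime hp TpH HatH hle cuspMeetsH).DeltaHat),
        (∀ x ∈ J i, x ∈ (ofSpecialFibre X d S h36 Sigma SigmaHat hsub hne hprime hp TpH HatH hle
          cuspMeetsH).ρHat.ker → a * x = x * a) → a ∈ J i) :
    (ofSpecialFibre X d S h36 Sigma SigmaHat hsub hne hprime hp TpH HatH hle cuspMeetsH).Cor23i ∧
      (ofSpecialFibre X d S h36 Sigma SigmaHat hsub hne hprime hp TpH HatH hle cuspMeetsH).Cor23ii ∧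
      (ofSpecialFibre X d S h36 Sigma SigmaHat hsub hne hprime hp TpH HatH hle cuspMeetsH).Cor23iii ∧
      (ofSpecialFibre X d S h36 Sigma SigmaHat hsub hne hprime hp TpH HatH hle cuspMeetsH).Cor23iv := by
  haveI := ofSpecialFibre_t2Space_piHat X d S h36 Sigma SigmaHat hsub hne hprime hp TpH HatH hle cuspMeetsH
  haveI := ofSpecialFibre_totallyDisconnectedSpace_piHat X d S h36 Sigma SigmaHat hsub hne hprime hp TpH
    HatH hle cuspMeetsH
  haveI := ofSpecialFibre_t2Space_graphHat X d S h36 Sigma SigmaHat hsub hne hprime hp TpH HatH hle cuspMeetsH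
  refine (ofSpecialFibre X d S h36 Sigma SigmaHat hsub hne hprime hp TpH HatH hle
      cuspMeetsH).cor23_i_to_iv_of_inputs
    (ofSpecialFibre_isClosed_deltaHat X d S h36 Sigma SigmaHat hsub hne hprime hp TpH HatH hle cuspMeetsH)
    (ofSpecialFibre_continuous_ρHat X d S h36 Sigma SigmaHat hsub hne hprime hp TpH HatH hle cuspMeetsH)
    h22 hH hker
    (ofSpecialFibre_center_Gk_eq_bot X d S h36 Sigma SigmaHat hsub hne hprime hp TpH HatH hle cuspMeetsH)
    hOutTp hOutHat J hcof (fun ha i a h => ?_) (fun hb i a h => ?_)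
  · -- (KER-LEVEL) ⇒ the `ℍ`-form level hypothesis (`TemperedCoveringsSlimnessKerForm.hlevel_of_kerLevel`)
    exact hA ha i a fun x hxJ hxK => h x hxJ ((ofSpecialFibre X d S h36 Sigma SigmaHat hsub hne hprime hp
      TpH HatH hle cuspMeetsH).ker_ρHat_le_deltaHatH hxK)
  · exact hB hb i a fun x hxJ hxK => h x hxJ ((ofSpecialFibre X d S h36 Sigma SigmaHat hsub hne hprime hp
      TpH HatH hle cuspMeetsH).ker_ρHat_le_deltaHatH hxK)

/-- **[IUTchI] Cor. 2.3 (iii) AS TYPED at the genuine datum, slimness BY NAME**: as the kernel of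
record `cor23iii_of_slim` with `Z(G_k) = 1` and `Π̂_X` Hausdorff DISCHARGED; remaining inputs (i),
(ii), the typed slimness clause `hslim` and the outer-descent atoms.
[cite: Mochizuki2012, Cor 2.3(iii) p.47] -/
theorem cor23iii_ofSpecialFibre_of_slim
    (hi : (ofSpecialFibre X d S h36 Sigma SigmaHat hsub hne hprime hp TpH HatH hle cuspMeetsH).Cor23i)
    (hii : (ofSpecialFibre X d S h36 Sigma SigmaHat hsub hne hprime hp TpH HatH hle cuspMeetsH).Cor23ii)
    (hslim : (ofSpecialFibre X d S h36 Sigma SigmaHat hsub hne hprime hp TpH HatH hle cuspMeetsH).Cor23Hyp →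
      IsSlimGroup (ofSpecialFibre X d S h36 Sigma SigmaHat hsub hne hprime hp TpH HatH hle cuspMeetsH).deltaHatH)
    (hOutTp : ∀ g : (ofSpecialFibre X d S h36 Sigma SigmaHat hsub hne hprime hp TpH HatH hle cuspMeetsH).PiTp,
      ∃ δ : (ofSpecialFibre X d S h36 Sigma SigmaHat hsub hne hprime hp TpH HatH hle cuspMeetsH).DeltaTp,
        MulAut.conj g • ((ofSpecialFibre X d S h36 Sigma SigmaHat hsub hne hprime hp TpH HatH hle
            cuspMeetsH).deltaTpH.map
          (ofSpecialFibre X d S h36 Sigma SigmaHat hsub hne hprime hp TpH HatH hle cuspMeetsH).DeltaTp.subtype) =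
        MulAut.conj (δ : (ofSpecialFibre X d S h36 Sigma SigmaHat hsub hne hprime hp TpH HatH hle
            cuspMeetsH).PiTp) •
          ((ofSpecialFibre X d S h36 Sigma SigmaHat hsub hne hprime hp TpH HatH hle cuspMeetsH).deltaTpH.map
            (ofSpecialFibre X d S h36 Sigma SigmaHat hsub hne hprime hp TpH HatH hle cuspMeetsH).DeltaTp.subtype))
    (hOutHat : ∀ γ : (ofSpecialFibre X d S h36 Sigma SigmaHat hsub hne hprime hp TpH HatH hle cuspMeetsH).PiHat,
      ∃ δ : (ofSpecialFibre X d S h36 Sigma SigmaHat hsub hne hprime hp TpH HatH hle cuspMeetsH).DeltaHat,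
        MulAut.conj γ • ((ofSpecialFibre X d S h36 Sigma SigmaHat hsub hne hprime hp TpH HatH hle
            cuspMeetsH).deltaHatH.map
          (ofSpecialFibre X d S h36 Sigma SigmaHat hsub hne hprime hp TpH HatH hle cuspMeetsH).DeltaHat.subtype) =
        MulAut.conj (δ : (ofSpecialFibre X d S h36 Sigma SigmaHat hsub hne hprime hp TpH HatH hle
            cuspMeetsH).PiHat) •
          ((ofSpecialFibre X d S h36 Sigma SigmaHat hsub hne hprime hp TpH HatH hle cuspMeetsH).deltaHatH.map
            (ofSpecialFibre X d S h36 Sigma SigmaHat hsub hne hprime hp TpH HatH hle cuspMeetsH).DeltaHat.subtype)) :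
    (ofSpecialFibre X d S h36 Sigma SigmaHat hsub hne hprime hp TpH HatH hle cuspMeetsH).Cor23iii := by
  haveI := ofSpecialFibre_t2Space_piHat X d S h36 Sigma SigmaHat hsub hne hprime hp TpH HatH hle cuspMeetsH
  exact (ofSpecialFibre X d S h36 Sigma SigmaHat hsub hne hprime hp TpH HatH hle cuspMeetsH).cor23iii_of_slim
    hi hii hslim
    (ofSpecialFibre_center_Gk_eq_bot X d S h36 Sigma SigmaHat hsub hne hprime hp TpH HatH hle cuspMeetsH)
    hOutTp hOutHat

/-- **[IUTchI] Cor. 2.3 (iv) AS TYPED at the genuine datum, slimness BY NAME** ((iv) ⇐ (i) + the exact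
sequences of (iii), p. 49), `Z(G_k) = 1` and `Π̂_X` Hausdorff DISCHARGED. [cite: Mochizuki2012, Cor 2.3(iv) p.49] -/
theorem cor23iv_ofSpecialFibre_of_slim
    (hi : (ofSpecialFibre X d S h36 Sigma SigmaHat hsub hne hprime hp TpH HatH hle cuspMeetsH).Cor23i)
    (hii : (ofSpecialFibre X d S h36 Sigma SigmaHat hsub hne hprime hp TpH HatH hle cuspMeetsH).Cor23ii)
    (hslim : (ofSpecialFibre X d S h36 Sigma SigmaHat hsub hne hprime hp TpH HatH hle cuspMeetsH).Cor23Hyp →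
      IsSlimGroup (ofSpecialFibre X d S h36 Sigma SigmaHat hsub hne hprime hp TpH HatH hle cuspMeetsH).deltaHatH)
    (hOutTp : ∀ g : (ofSpecialFibre X d S h36 Sigma SigmaHat hsub hne hprime hp TpH HatH hle cuspMeetsH).PiTp,
      ∃ δ : (ofSpecialFibre X d S h36 Sigma SigmaHat hsub hne hprime hp TpH HatH hle cuspMeetsH).DeltaTp,
        MulAut.conj g • ((ofSpecialFibre X d S h36 Sigma SigmaHat hsub hne hprime hp TpH HatH hle
            cuspMeetsH).deltaTpH.map
          (ofSpecialFibre X d S h36 Sigma SigmaHat hsub hne hprime hp TpH HatH hle cuspMeetsH).DeltaTp.subtype) =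
        MulAut.conj (δ : (ofSpecialFibre X d S h36 Sigma SigmaHat hsub hne hprime hp TpH HatH hle
            cuspMeetsH).PiTp) •
          ((ofSpecialFibre X d S h36 Sigma SigmaHat hsub hne hprime hp TpH HatH hle cuspMeetsH).deltaTpH.map
            (ofSpecialFibre X d S h36 Sigma SigmaHat hsub hne hprime hp TpH HatH hle cuspMeetsH).DeltaTp.subtype))
    (hOutHat : ∀ γ : (ofSpecialFibre X d S h36 Sigma SigmaHat hsub hne hprime hp TpH HatH hle cuspMeetsH).PiHat,
      ∃ δ : (ofSpecialFibre X d S h36 Sigma SigmaHat hsub hne hprime hp TpH HatH hle cuspMeetsH).DeltaHat,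
        MulAut.conj γ • ((ofSpecialFibre X d S h36 Sigma SigmaHat hsub hne hprime hp TpH HatH hle
            cuspMeetsH).deltaHatH.map
          (ofSpecialFibre X d S h36 Sigma SigmaHat hsub hne hprime hp TpH HatH hle cuspMeetsH).DeltaHat.subtype) =
        MulAut.conj (δ : (ofSpecialFibre X d S h36 Sigma SigmaHat hsub hne hprime hp TpH HatH hle
            cuspMeetsH).PiHat) •
          ((ofSpecialFibre X d S h36 Sigma SigmaHat hsub hne hprime hp TpH HatH hle cuspMeetsH).deltaHatH.map
            (ofSpecialFibre X d S h36 Sigma SigmaHat hsub hne hprime hp TpH HatH hle cuspMeetsH).DeltaHat.subtype)) :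
    (ofSpecialFibre X d S h36 Sigma SigmaHat hsub hne hprime hp TpH HatH hle cuspMeetsH).Cor23iv :=
  (ofSpecialFibre X d S h36 Sigma SigmaHat hsub hne hprime hp TpH HatH hle cuspMeetsH).cor23iv_of_cor23i hi
    (cor23iii_ofSpecialFibre_of_slim X d S h36 Sigma SigmaHat hsub hne hprime hp TpH HatH hle cuspMeetsH hi hii
      hslim hOutTp hOutHat)

end

end StableCurveTemperedData

end Literature.IUT.HodgeTheaters

end
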